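import Summits.CriticalPhenomena.Ising3DConformalLimit.Theorems.RotationUpgradeFromTwoPoint.Negative.CubicDecoy

/-!
# `RotationUpgradeFromTwoPoint` (item stmt-CriticalPhenomena-8367): symmetries and structure of the cubic decoy

Second file of the cubic decoy `cubicFamily Δ` (see `Negative/CubicDecoy.lean` for the definition and
the algebra of `quartic`/`aniso`): translation invariance, scale covariance with `Δ`, vanishing odd
orders, normalisation off `NonCoincident` (`Δ ≠ 0`), non-degenerate and `O(3)`-invariant two-point
function (the crux's hypothesis (H7) holds EXACTLY), permutation symmetry, `B₃` invariance
(coordinate permutations and sign flips), the connected four-point function `U₄ = -bump·aniso`, the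
Lebowitz sign, the Aizenman–Griffiths domination `|U₄| ≤ S₂²` and positivity of all correlations.
Standing crux disprover (D-0016), cycle 1.
-/

noncomputable section

namespace Summit.CriticalPhenomena.Ising3DConformalLimit.RotationUpgradeFromTwoPointNegative

open Literature.Probability.LatticeModels Literature.Barriers.CriticalPhenomena
open Literature.MathematicalPhysics.QuantumFieldTheory
open Filter Set Function ScaleNotMoebius
open scoped Topology

/-! #### Symmetries and structure of the cubic decoy -/

/-- The cubic decoy is translation invariant. [folklore] -/
theorem cubicFamily_isTranslationInvariant (Δ : ℝ) : IsTranslationInvariant (cubicFamily Δ) := by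
  intro n v x
  match n, x with
  | 0, _ => rfl
  | 1, _ => rfl
  | 2, x => simp [cubicFamily_two, twoPt]
  | 3, _ => rfl
  | 4, x =>
    have hinj := injective_comp_iff (add_left_injective v) x
    by_cases hx : Function.Injective x
    · rw [cubicFamily_four_of_injective Δ (hinj.2 hx), cubicFamily_four_of_injective Δ hx,
        wick_add, bump_add, aniso_add]
    · rw [cubicFamily_four_of_not_injective Δ (mt hinj.1 hx),
        cubicFamily_four_of_not_injective Δ hx]
  | (n + 5), _ => rfl

/-- The cubic decoy is scale covariant with dimension `Δ`. [folklore] -/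
theorem cubicFamily_isScaleCovariant (Δ : ℝ) : IsScaleCovariant Δ (cubicFamily Δ) := by
  intro n c hc x
  match n, x with
  | 0, _ => simp [cubicFamily_zero]
  | 1, _ => simp [cubicFamily]
  | 2, x =>
    have h1 : (-((2 : ℕ) : ℝ) * Δ) = -(2 * Δ) := by push_cast; ring
    rw [cubicFamily_two, cubicFamily_two, h1, twoPt_smul Δ hc]
  | 3, _ => simp [cubicFamily]
  | 4, x =>
    have h1 : (-((4 : ℕ) : ℝ) * Δ) = -(2 * Δ) + -(2 * Δ) := by push_cast; ring
    rw [h1, Real.rpow_add hc]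
    have hinj := injective_comp_iff (smul_right_injective _ hc.ne') x
    by_cases hx : Function.Injective x
    · rw [cubicFamily_four_of_injective Δ (hinj.2 hx), cubicFamily_four_of_injective Δ hx,
        wick_smul Δ hc, bump_smul Δ hc, aniso_smul hc]
      ring
    · rw [cubicFamily_four_of_not_injective Δ (mt hinj.1 hx),
        cubicFamily_four_of_not_injective Δ hx, mul_zero]
  | (n + 5), _ => simp [cubicFamily]

/-- The cubic decoy has vanishing odd correlations. [folklore] -/
theorem cubicFamily_odd (Δ : ℝ) {n : ℕ} (hn : Odd n) (x : Fin n → (EuclideanSpace ℝ (Fin 3))) : cubicFamily Δ n x = 0 := by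
  match n, hn, x with
  | 0, hn, _ => exact absurd hn (by decide)
  | 2, hn, _ => exact absurd hn (by decide)
  | 4, hn, _ => exact absurd hn (by decide)
  | 1, _, _ => rfl
  | 3, _, _ => rfl
  | (n + 5), _, _ => rfl

/-- The cubic decoy is normalised: it vanishes on coincident configurations (`Δ ≠ 0`). [folklore] -/
theorem cubicFamily_eq_zero_of_not_mem {Δ : ℝ} (hΔ : Δ ≠ 0) (n : ℕ) (x : Fin n → (EuclideanSpace ℝ (Fin 3)))
    (hx : x ∉ NonCoincident 3 n) : cubicFamily Δ n x = 0 := by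
  rw [mem_nonCoincident] at hx
  match n, x, hx with
  | 0, x, hx => exact absurd (Function.injective_of_subsingleton x) hx
  | 1, _, _ => rfl
  | 2, x, hx =>
    rw [injective_fin_two_iff, not_not] at hx
    rw [cubicFamily_two, hx, twoPt_self hΔ]
  | 3, _, _ => rfl
  | 4, x, hx => exact cubicFamily_four_of_not_injective Δ hx
  | (n + 5), _, _ => rfl

/-- The cubic decoy has a non-degenerate two-point function. [folklore] -/
theorem cubicFamily_isNondegenerateTwoPoint (Δ : ℝ) : IsNondegenerateTwoPoint (cubicFamily Δ) := by
  intro x hx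
  rw [cubicFamily_two]
  exact twoPt_pos Δ ((injective_fin_two_iff x).1 ((mem_nonCoincident x).1 hx))

/-- The cubic decoy has an `O(3)`-invariant two-point kernel (hypothesis (H7) of the crux): it is
the exact conformal two-point function `‖x‖^{-2Δ}`. [folklore] -/
theorem cubicFamily_twoPointIsotropic (Δ : ℝ) :
    ∀ (R : (EuclideanSpace ℝ (Fin 3)) ≃ₗᵢ[ℝ] (EuclideanSpace ℝ (Fin 3))) (x : (EuclideanSpace ℝ (Fin 3))), x ≠ 0 → cubicFamily Δ 2 ![0, R x] = cubicFamily Δ 2 ![0, x] := by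
  intro R x _
  rw [cubicFamily_two, cubicFamily_two]
  simp [twoPt]

/-- Indeed the whole two-point function of the decoy is `O(3)` invariant. [folklore] -/
theorem cubicFamily_two_rot (Δ : ℝ) (R : (EuclideanSpace ℝ (Fin 3)) ≃ₗᵢ[ℝ] (EuclideanSpace ℝ (Fin 3))) (x : Fin 2 → (EuclideanSpace ℝ (Fin 3))) :
    cubicFamily Δ 2 (fun i => R (x i)) = cubicFamily Δ 2 x := by
  rw [cubicFamily_two, cubicFamily_two, twoPt_map]

/-- The cubic decoy is permutation symmetric (OS axiom E3). [folklore] -/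
theorem cubicFamily_isPermutationSymmetric (Δ : ℝ) : IsPermutationSymmetric (cubicFamily Δ) := by
  intro n σ x
  match n, σ, x with
  | 0, _, _ => rfl
  | 1, _, _ => rfl
  | 3, _, _ => rfl
  | (n + 5), _, _ => rfl
  | 2, σ, x =>
    have h := narrowFamily_perm Δ 2 σ x
    rwa [narrowFamily_two, narrowFamily_two] at h
  | 4, σ, x =>
    have hinj : Function.Injective (x ∘ σ) ↔ Function.Injective x := Equiv.injective_comp _ x
    by_cases hx : Function.Injective x
    · have hw : wick Δ (x ∘ σ) = wick Δ x := by
        have h := narrowFamily_perm Δ 4 σ x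
        rw [narrowFamily_four_of_injective Δ (hinj.2 hx), narrowFamily_four_of_injective Δ hx,
          bump, bump, sqSum_comp_perm] at h
        linarith
      rw [cubicFamily_four_of_injective Δ (hinj.2 hx), cubicFamily_four_of_injective Δ hx, hw,
        bump, bump, sqSum_comp_perm, aniso_comp_perm]
    · rw [cubicFamily_four_of_not_injective Δ (mt hinj.1 hx), cubicFamily_four_of_not_injective Δ hx]

/-- The cubic decoy is invariant under the coordinate permutations of `ℝ³` (first half of `B₃`).
[folklore] -/
theorem cubicFamily_coordPerm (Δ : ℝ) (π : Equiv.Perm (Fin 3)) (n : ℕ) (x : Fin n → (EuclideanSpace ℝ (Fin 3))) :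
    cubicFamily Δ n (fun i => LinearIsometryEquiv.piLpCongrLeft 2 ℝ ℝ π (x i)) = cubicFamily Δ n x := by
  match n, x with
  | 0, _ => rfl
  | 1, _ => rfl
  | 2, x => exact cubicFamily_two_rot Δ _ x
  | 3, _ => rfl
  | 4, x =>
    set P := LinearIsometryEquiv.piLpCongrLeft 2 ℝ ℝ π
    have hinj := injective_comp_iff P.injective x
    by_cases hx : Function.Injective x
    · rw [cubicFamily_four_of_injective Δ (hinj.2 hx), cubicFamily_four_of_injective Δ hx,
        wick_map, bump_map, aniso_coordPerm]
    · rw [cubicFamily_four_of_not_injective Δ (mt hinj.1 hx), cubicFamily_four_of_not_injective Δ hx]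
  | (n + 5), _ => rfl

/-- The cubic decoy is invariant under the coordinate sign flips of `ℝ³` (second half of `B₃`).
[folklore] -/
theorem cubicFamily_signFlip (Δ : ℝ) (ε : Fin 3 → ℤˣ) (R : (EuclideanSpace ℝ (Fin 3)) ≃ₗᵢ[ℝ] (EuclideanSpace ℝ (Fin 3)))
    (hR : ∀ (p : (EuclideanSpace ℝ (Fin 3))) (j : Fin 3), R p j = ((ε j : ℤ) : ℝ) * p j) (n : ℕ) (x : Fin n → (EuclideanSpace ℝ (Fin 3))) :
    cubicFamily Δ n (fun i => R (x i)) = cubicFamily Δ n x := by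
  match n, x with
  | 0, _ => rfl
  | 1, _ => rfl
  | 2, x => exact cubicFamily_two_rot Δ R x
  | 3, _ => rfl
  | 4, x =>
    have hinj := injective_comp_iff R.injective x
    by_cases hx : Function.Injective x
    · rw [cubicFamily_four_of_injective Δ (hinj.2 hx), cubicFamily_four_of_injective Δ hx,
        wick_map, bump_map, aniso_signFlip ε R hR]
    · rw [cubicFamily_four_of_not_injective Δ (mt hinj.1 hx), cubicFamily_four_of_not_injective Δ hx]
  | (n + 5), _ => rfl

/-- The connected four-point function of the decoy at a non-coincident quadruple is
`-bump · aniso`. [folklore] -/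
theorem limitConnectedFour_cubicFamily (Δ : ℝ) {x : Fin 4 → (EuclideanSpace ℝ (Fin 3))} (hx : Function.Injective x) :
    limitConnectedFour (cubicFamily Δ) x = -(bump Δ x * aniso x) := by
  simp only [limitConnectedFour, cubicFamily_four_of_injective Δ hx, cubicFamily_two, wick,
    Matrix.cons_val_zero, Matrix.cons_val_one]
  ring

/-- At a coincident quadruple the connected function is minus the Wick sum. [folklore] -/
theorem limitConnectedFour_cubicFamily_of_not_injective (Δ : ℝ) {x : Fin 4 → (EuclideanSpace ℝ (Fin 3))}
    (hx : ¬ Function.Injective x) : limitConnectedFour (cubicFamily Δ) x = -wick Δ x := by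
  simp only [limitConnectedFour, cubicFamily_four_of_not_injective Δ hx, cubicFamily_two, wick,
    Matrix.cons_val_zero, Matrix.cons_val_one]
  ring

/-- Lebowitz sign: `U₄ ≤ 0` everywhere for the decoy. [folklore] -/
theorem limitConnectedFour_cubicFamily_nonpos (Δ : ℝ) (x : Fin 4 → (EuclideanSpace ℝ (Fin 3))) :
    limitConnectedFour (cubicFamily Δ) x ≤ 0 := by
  by_cases hx : Function.Injective x
  · rw [limitConnectedFour_cubicFamily Δ hx, neg_nonpos]
    exact mul_nonneg (bump_nonneg Δ x) (aniso_nonneg x)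
  · rw [limitConnectedFour_cubicFamily_of_not_injective Δ hx, neg_nonpos]
    exact wick_nonneg Δ x

/-- Aizenman–Griffiths-type domination: `|U₄| ≤ S₂(xᵢ,xⱼ)²` for every pair (`Δ ≥ 0`). [folklore] -/
theorem abs_limitConnectedFour_cubicFamily_le {Δ : ℝ} (hΔ : 0 ≤ Δ) {x : Fin 4 → (EuclideanSpace ℝ (Fin 3))}
    (hx : x ∈ NonCoincident 3 4) {i j : Fin 4} (hij : i ≠ j) :
    |limitConnectedFour (cubicFamily Δ) x| ≤ cubicFamily Δ 2 ![x i, x j] ^ 2 := by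
  have hinj : Function.Injective x := (mem_nonCoincident x).1 hx
  rw [limitConnectedFour_cubicFamily Δ hinj, abs_neg, cubicFamily_two,
    abs_of_nonneg (mul_nonneg (bump_nonneg Δ x) (aniso_nonneg x))]
  simp only [Matrix.cons_val_zero, Matrix.cons_val_one]
  calc bump Δ x * aniso x ≤ bump Δ x * 1 :=
        mul_le_mul_of_nonneg_left (aniso_le_one x) (bump_nonneg Δ x)
    _ ≤ twoPt Δ (x i) (x j) ^ 2 := by rw [mul_one]; exact bump_le_twoPt_sq hΔ (hinj.ne hij)

/-- Griffiths-I shape: all correlations of the decoy are `≥ 0` (`Δ ≥ 0`). [folklore] -/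
theorem cubicFamily_nonneg {Δ : ℝ} (hΔ : 0 ≤ Δ) (n : ℕ) (x : Fin n → (EuclideanSpace ℝ (Fin 3))) : 0 ≤ cubicFamily Δ n x := by
  match n, x with
  | 0, _ => exact zero_le_one
  | 1, _ => exact le_rfl
  | 2, x => rw [cubicFamily_two]; exact twoPt_nonneg Δ _ _
  | 3, _ => exact le_rfl
  | 4, x =>
    by_cases hx : Function.Injective x
    · rw [cubicFamily_four_of_injective Δ hx]
      have h01 : x 0 ≠ x 1 := hx.ne (by decide)
      have h23 : x 2 ≠ x 3 := hx.ne (by decide)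
      have hb : bump Δ x * aniso x ≤ twoPt Δ (x 0) (x 1) * twoPt Δ (x 2) (x 3) :=
        calc bump Δ x * aniso x ≤ bump Δ x * 1 :=
              mul_le_mul_of_nonneg_left (aniso_le_one x) (bump_nonneg Δ x)
          _ ≤ twoPt Δ (x 0) (x 1) * twoPt Δ (x 2) (x 3) := by
              rw [mul_one]; exact bump_le_twoPt_mul_twoPt hΔ h01 h23
      have hw := twoPt_nonneg Δ
      unfold wick
      nlinarith [hw (x 0) (x 2), hw (x 1) (x 3), hw (x 0) (x 3), hw (x 1) (x 2),
        mul_nonneg (hw (x 0) (x 2)) (hw (x 1) (x 3)), mul_nonneg (hw (x 0) (x 3)) (hw (x 1) (x 2))]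
    · rw [cubicFamily_four_of_not_injective Δ hx]
  | (n + 5), _ => exact le_rfl

end Summit.CriticalPhenomena.Ising3DConformalLimit.RotationUpgradeFromTwoPointNegative

end
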